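import Literature.Probability.LatticeModels.CoarseCellMixingCounting
import HarnessLib

/-!
# Coarse-cell mixing with defects, I: block quasi-locality in ratio form

Ninth companion (theorems + one named hypothesis) file of
`Literature/Probability/LatticeModels/CoarseCellFiniteSize.lean`. The defect-free
Dobrushin–Shlosman recursion of `CoarseCellMixing{Recursion,Decay,Leak,Engine}` only ever reads the
CENTRAL-cell marginal of a cube kernel (`HasLeak`, `IsGoodFS`). Once the finite-size condition has
Peierls-rare DEFECTS (bad cells, next to which it says nothing), an expansion around the bad
clusters has to resample a whole fattened cluster at once and needs the quasi-locality of the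
resulting BLOCK kernel for arbitrary block-local observables. This file supplies that
vocabulary:

* `HasBlockLeak cell γ a r` — ratio-form quasi-locality of the kernels `γ_A(· | ζ)` of ARBITRARY
  cell-unions `A` for `A`-local `[0,1]`-valued observables: exteriors agreeing on the cells within
  coarse distance `D + 1` of `A` change kernel expectations at most by the factor
  `exp(a · cellCount A · e^{-rD})` (the form in which a bounded quasi-local perturbation of a
  block-Markov specification is quasi-local, Georgii 2011, Ch. 8);
* `hasLeak_of_hasBlockLeak` — it implies the central-cell leak profile `HasLeak cell γ n Λl r` of
  `CoarseCellFiniteSize` with `Λl = exp(a (4n+1)^d) - 1`, for every window `n`;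
* `abs_sub_le_sub_one_mul_of_le_mul` — the signed form of a two-sided ratio bound
  (`|I - I'| ≤ (F - 1) max(I, I')`), which keeps the smallness of an observable supported on a
  rare event (`abs_kernel_sub_le_of_hasBlockLeak`).

The kernel bounds for bad cells and the chain rule with defects are in
`CoarseCellMixingDefectsChain.lean`.

## References

* H.-O. Georgii, *Gibbs Measures and Phase Transitions*, 2nd ed. (de Gruyter 2011), Ch. 8.
* R. L. Dobrushin, S. B. Shlosman, *Completely analytical interactions: constructive description*,
  J. Stat. Phys. 46 (1987) (quasi-locality / complete analyticity conditions on arbitrary volumes).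
* J. van den Berg, C. Maes, *Disagreement percolation in the study of Markov fields*,
  Ann. Probab. 22 (1994).
-/

noncomputable section

open _root_.MeasureTheory
open scoped ENNReal

namespace Literature.Probability.LatticeModels

variable {d : ℕ} {μc : Fin d → ℕ} {V S : Type*} [MeasurableSpace S]

/-! ### Block quasi-locality in ratio form -/

/-- **Block quasi-locality of a specification, ratio form**: for every cell-union volume `A`,
every `D`, every two exteriors `ζ, ζ'` that agree on all sites whose cell is within coarse distance
`D + 1` of a cell of `A`, and every measurable `[0,1]`-valued observable `f` reading only `A` and
agreeing sites, `γ_A f(ζ) ≤ exp(a · cellCount A · e^{-rD}) · γ_A f(ζ')` (and symmetrically, the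
hypothesis being symmetric). A block-Markov specification has `a = 0`; a perturbation of one by an
interaction of sup-norm `η` per block and range-`κ` exponential decay has `a ≍ η`, `r = κ`.
[cite: Georgii2011, Ch. 8] -/
def HasBlockLeak [Fintype V] (cell : V → CoarseIdx μc) (γ : Specification V S) (a r : ℝ) : Prop :=
  ∀ (A : Finset V), (∀ v w, cell v = cell w → v ∈ A → w ∈ A) →
    ∀ (D : ℕ) (ζ ζ' : V → S),
      (∀ v, (∃ w ∈ A, cdist (cell w) (cell v) ≤ D + 1) → ζ v = ζ' v) →
      ∀ f : (V → S) → ℝ, Measurable f → (∀ σ, 0 ≤ f σ ∧ f σ ≤ 1) →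
        DependsOn f {v | v ∈ A ∨ ζ v = ζ' v} →
        ∫ σ, f σ ∂(γ A ζ) ≤
          Real.exp (a * cellCount cell A * Real.exp (-(r * D))) * ∫ σ, f σ ∂(γ A ζ')

/-- **Signed form of a two-sided ratio bound**: if `I ≤ F I'` and `I' ≤ F I` with `F ≥ 1`
then `|I - I'| ≤ (F - 1) · max I I'`. Applied to the expectations of an observable supported on a
rare event, the right-hand side keeps the probability of the event as a factor. [folklore] -/
theorem abs_sub_le_sub_one_mul_of_le_mul {I I' F : ℝ} (hF : 1 ≤ F)
    (h₁ : I ≤ F * I') (h₂ : I' ≤ F * I) : |I - I'| ≤ (F - 1) * max I I' := by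
  have hm : I ≤ max I I' := le_max_left _ _
  have hm' : I' ≤ max I I' := le_max_right _ _
  rw [abs_sub_le_iff]
  constructor <;> nlinarith

/-- **Block quasi-locality implies the central leak profile**: `HasBlockLeak cell γ a r` with
`a, r ≥ 0` gives `HasLeak cell γ n (exp(a (4n+1)^d) - 1) r` for every window `n` (a cell-union
inside the cube of radius `2n` meets `≤ (4n+1)^d` cells, exteriors agreeing on the cube of radius
`2n+1+D` agree `(D+1)`-near the block, and `e^{tX} - 1 ≤ t (e^X - 1)` for `t = e^{-rD} ≤ 1`).
[cite: Georgii2011, Ch. 8] -/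
theorem hasLeak_of_hasBlockLeak [Fintype V] {cell : V → CoarseIdx μc} {γ : Specification V S}
    (hγ : IsSpecification γ) {a r : ℝ} (ha : 0 ≤ a) (hr : 0 ≤ r) (hBL : HasBlockLeak cell γ a r)
    (n : ℕ) : HasLeak cell γ n (Real.exp (a * ((4 * n + 1) ^ d : ℕ)) - 1) r := by
  intro c A hA hAunion D ζ ζ' hagree f hf hf01 hfdep
  -- exteriors agreeing on the cube of radius `2n+1+D` agree `(D+1)`-near the block
  have hagree' : ∀ v, (∃ w ∈ A, cdist (cell w) (cell v) ≤ D + 1) → ζ v = ζ' v := by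
    rintro v ⟨w, hw, hwv⟩
    apply hagree v
    calc cdist c (cell v) ≤ cdist c (cell w) + cdist (cell w) (cell v) := cdist_triangle _ _ _
      _ ≤ 2 * n + (D + 1) := add_le_add (hA w hw) hwv
      _ = 2 * n + 1 + D := by ring
  have hcc : ∀ v, cell v = c → ζ v = ζ' v := fun v hv =>
    hagree v (by rw [hv, cdist_self]; exact Nat.zero_le _)
  have hdep : DependsOn f {v | v ∈ A ∨ ζ v = ζ' v} :=
    hfdep.mono fun v hv => Or.inr (hcc v hv)
  have hdep' : DependsOn f {v | v ∈ A ∨ ζ' v = ζ v} :=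
    hfdep.mono fun v hv => Or.inr (hcc v hv).symm
  haveI := hγ.isProbability A ζ
  haveI := hγ.isProbability A ζ'
  set F : ℝ := Real.exp (a * cellCount cell A * Real.exp (-(r * D))) with hF
  set I : ℝ := ∫ σ, f σ ∂(γ A ζ) with hI
  set I' : ℝ := ∫ σ, f σ ∂(γ A ζ') with hI'
  have h12 : I ≤ F * I' := hBL A hAunion D ζ ζ' hagree' f hf hf01 hdep
  have h21 : I' ≤ F * I := hBL A hAunion D ζ' ζ (fun v hv => (hagree' v hv).symm) f hf hf01 hdep'
  obtain ⟨hI0, hI1⟩ := integral_mem_unitInterval (μ := γ A ζ) hf hf01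
  obtain ⟨hI'0, hI'1⟩ := integral_mem_unitInterval (μ := γ A ζ') hf hf01
  have hF1 : 1 ≤ F := Real.one_le_exp (by positivity)
  have habs : |I - I'| ≤ F - 1 := by
    rw [abs_le]; constructor <;> nlinarith
  -- `F - 1 ≤ e^{-rD} (exp(a (4n+1)^d) - 1)`
  set t : ℝ := Real.exp (-(r * D)) with ht
  have ht0 : 0 ≤ t := (Real.exp_pos _).le
  have ht1 : t ≤ 1 := Real.exp_le_one_iff.2 (by simp only [Left.neg_nonpos_iff]; positivity)
  have hk : (cellCount cell A : ℝ) ≤ ((4 * n + 1) ^ d : ℕ) := by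
    exact_mod_cast cellCount_le_of_subset_cube cell c n A hA
  have hX : a * cellCount cell A ≤ a * ((4 * n + 1) ^ d : ℕ) := mul_le_mul_of_nonneg_left hk ha
  have hFt : F = Real.exp (t * (a * cellCount cell A)) := by rw [hF]; ring_nf
  -- convexity of the exponential: `e^{ts} - 1 ≤ t (e^s - 1)` for `t ∈ [0,1]`
  -- (as `QuasiLocalGaugePerturbation.exp_mul_sub_one_le_mul`, not imported here)
  have hconv : ∀ s : ℝ, Real.exp (t * s) - 1 ≤ t * (Real.exp s - 1) := fun s => by
    have h := convexOn_exp.2 (Set.mem_univ 0) (Set.mem_univ s) (by linarith : 0 ≤ 1 - t) ht0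
      (by ring)
    simp only [smul_eq_mul, mul_zero, zero_add, Real.exp_zero, mul_one] at h
    linarith
  have hF' : F - 1 ≤ t * (Real.exp (a * ((4 * n + 1) ^ d : ℕ)) - 1) := by
    rw [hFt]
    refine (hconv _).trans (mul_le_mul_of_nonneg_left ?_ ht0)
    exact sub_le_sub_right (Real.exp_le_exp.2 hX) 1
  calc |I - I'| ≤ F - 1 := habs
    _ ≤ t * (Real.exp (a * ((4 * n + 1) ^ d : ℕ)) - 1) := hF'
    _ = (Real.exp (a * ((4 * n + 1) ^ d : ℕ)) - 1) * Real.exp (-(r * D)) := mul_comm _ _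

/-- **Signed block observables supported on an event**: under `HasBlockLeak cell γ a r`, for a
measurable `Ψ` reading only the block `A` with `|Ψ| ≤ lam · 1_E` (`E` an `A`-local measurable
event) and two exteriors agreeing `(D+1)`-near `A`,
`|γ_A Ψ(ζ) - γ_A Ψ(ζ')| ≤ 2 (F - 1) · lam · max(γ_A(E | ζ), γ_A(E | ζ'))` with
`F = exp(a · cellCount A · e^{-rD})`: the positive and negative parts of `Ψ / lam` are
`[0,1]`-valued, `A`-local and dominated by `1_E`. [folklore] -/
theorem abs_kernel_sub_le_of_hasBlockLeak [Fintype V] {cell : V → CoarseIdx μc}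
    {γ : Specification V S} (hγ : IsSpecification γ) {a r : ℝ}
    (hBL : HasBlockLeak cell γ a r) (A : Finset V) (hA : ∀ v w, cell v = cell w → v ∈ A → w ∈ A)
    (D : ℕ) (ζ ζ' : V → S) (hagree : ∀ v, (∃ w ∈ A, cdist (cell w) (cell v) ≤ D + 1) → ζ v = ζ' v)
    {Ψ : (V → S) → ℝ} (hΨm : Measurable Ψ) (hΨdep : DependsOn Ψ (↑A : Set V))
    {E : Set (V → S)} (hE : MeasurableSet E) {lam : ℝ} (hlam : 0 < lam)
    (hΨE : ∀ σ, |Ψ σ| ≤ lam * E.indicator 1 σ) :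
    |∫ σ, Ψ σ ∂(γ A ζ) - ∫ σ, Ψ σ ∂(γ A ζ')| ≤
      2 * (Real.exp (a * cellCount cell A * Real.exp (-(r * D))) - 1) * lam *
        max ((γ A ζ).real E) ((γ A ζ').real E) := by
  haveI := hγ.isProbability A ζ
  haveI := hγ.isProbability A ζ'
  set F : ℝ := Real.exp (a * cellCount cell A * Real.exp (-(r * D))) with hF
  -- positive and negative parts, normalised
  set P : (V → S) → ℝ := fun σ => max (Ψ σ) 0 / lam with hP
  set N : (V → S) → ℝ := fun σ => max (-Ψ σ) 0 / lam with hN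
  have hPm : Measurable P := (hΨm.max measurable_const).div_const lam
  have hNm : Measurable N := (hΨm.neg.max measurable_const).div_const lam
  have hind : ∀ σ, E.indicator (1 : (V → S) → ℝ) σ ≤ 1 := fun σ => by
    by_cases h : σ ∈ E <;> simp [h]
  have hind0 : ∀ σ, 0 ≤ E.indicator (1 : (V → S) → ℝ) σ := fun σ => by
    by_cases h : σ ∈ E <;> simp [h]
  have hPle : ∀ σ, P σ ≤ E.indicator 1 σ := fun σ => by
    have h := (abs_le.1 (hΨE σ)).2
    rw [hP, div_le_iff₀ hlam]
    refine max_le (by linarith) ?_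
    have := hind0 σ; positivity
  have hNle : ∀ σ, N σ ≤ E.indicator 1 σ := fun σ => by
    have h := (abs_le.1 (hΨE σ)).1
    rw [hN, div_le_iff₀ hlam]
    refine max_le (by linarith) ?_
    have := hind0 σ; positivity
  have hP01 : ∀ σ, 0 ≤ P σ ∧ P σ ≤ 1 := fun σ =>
    ⟨div_nonneg (le_max_right _ _) hlam.le, (hPle σ).trans (hind σ)⟩
  have hN01 : ∀ σ, 0 ≤ N σ ∧ N σ ≤ 1 := fun σ =>
    ⟨div_nonneg (le_max_right _ _) hlam.le, (hNle σ).trans (hind σ)⟩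
  have hdepP : ∀ η η' : V → S, DependsOn P {v | v ∈ A ∨ η v = η' v} := fun η η' σ τ h => by
    simp only [hP, hΨdep fun v hv => h v (Or.inl hv)]
  have hdepN : ∀ η η' : V → S, DependsOn N {v | v ∈ A ∨ η v = η' v} := fun η η' σ τ h => by
    simp only [hN, hΨdep fun v hv => h v (Or.inl hv)]
  have hagree' : ∀ v, (∃ w ∈ A, cdist (cell w) (cell v) ≤ D + 1) → ζ' v = ζ v :=
    fun v hv => (hagree v hv).symm
  -- the decomposition `Ψ = lam (P - N)`
  have hΨPN : ∀ σ, Ψ σ = lam * (P σ - N σ) := fun σ => by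
    simp only [hP, hN]
    rw [← sub_div, mul_div_cancel₀ _ hlam.ne']
    rcases le_total 0 (Ψ σ) with h | h
    · rw [max_eq_left h, max_eq_right (by linarith)]; ring
    · rw [max_eq_right h, max_eq_left (by linarith)]; ring
  have hPi : ∀ η, Integrable P (γ A η) := fun η => by
    haveI := hγ.isProbability A η
    exact DobrushinMetric.integrable_of_abs_le' hPm (M := 1) fun σ => by
      rw [abs_of_nonneg (hP01 σ).1]; exact (hP01 σ).2
  have hNi : ∀ η, Integrable N (γ A η) := fun η => by
    haveI := hγ.isProbability A η
    exact DobrushinMetric.integrable_of_abs_le' hNm (M := 1) fun σ => by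
      rw [abs_of_nonneg (hN01 σ).1]; exact (hN01 σ).2
  have hint : ∀ η, ∫ σ, Ψ σ ∂(γ A η) = lam * (∫ σ, P σ ∂(γ A η) - ∫ σ, N σ ∂(γ A η)) := by
    intro η
    simp_rw [hΨPN]
    rw [integral_const_mul, integral_sub (hPi η) (hNi η)]
  -- expectations of `P`, `N` are at most the probability of `E`
  have hexpE : ∀ (η : V → S) (Q : (V → S) → ℝ), Measurable Q → (∀ σ, 0 ≤ Q σ ∧ Q σ ≤ 1) →
      (∀ σ, Q σ ≤ E.indicator 1 σ) → ∫ σ, Q σ ∂(γ A η) ≤ (γ A η).real E := by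
    intro η Q hQm hQ01 hQE
    haveI := hγ.isProbability A η
    have hQi : Integrable Q (γ A η) := DobrushinMetric.integrable_of_abs_le' hQm (M := 1) fun σ => by
      rw [abs_of_nonneg (hQ01 σ).1]; exact (hQ01 σ).2
    calc ∫ σ, Q σ ∂(γ A η) ≤ ∫ σ, E.indicator 1 σ ∂(γ A η) :=
          integral_mono hQi ((integrable_const (1 : ℝ)).indicator hE) hQE
      _ = (γ A η).real E := integral_indicator_one hE
  -- the ratio bounds for `P` and `N`
  have hF1 : 1 ≤ F := by
    have h := hBL A hA D ζ ζ' hagree (fun _ => 1) measurable_const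
      (fun _ => ⟨zero_le_one, le_rfl⟩) (fun _ _ _ => rfl)
    simp only [integral_const, probReal_univ, smul_eq_mul, mul_one] at h
    exact h
  have hbd : ∀ (Q : (V → S) → ℝ), Measurable Q → (∀ σ, 0 ≤ Q σ ∧ Q σ ≤ 1) →
      (∀ η η' : V → S, DependsOn Q {v | v ∈ A ∨ η v = η' v}) → (∀ σ, Q σ ≤ E.indicator 1 σ) →
      |∫ σ, Q σ ∂(γ A ζ) - ∫ σ, Q σ ∂(γ A ζ')| ≤
        (F - 1) * max ((γ A ζ).real E) ((γ A ζ').real E) := by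
    intro Q hQm hQ01 hQdep hQE
    have h1 := hBL A hA D ζ ζ' hagree Q hQm hQ01 (hQdep ζ ζ')
    have h2 := hBL A hA D ζ' ζ hagree' Q hQm hQ01 (hQdep ζ' ζ)
    refine (abs_sub_le_sub_one_mul_of_le_mul hF1 h1 h2).trans ?_
    exact mul_le_mul_of_nonneg_left
      (max_le_max (hexpE ζ Q hQm hQ01 hQE) (hexpE ζ' Q hQm hQ01 hQE)) (by linarith)
  have hPb := hbd P hPm hP01 hdepP hPle
  have hNb := hbd N hNm hN01 hdepN hNle
  rw [hint ζ, hint ζ', ← mul_sub, abs_mul, abs_of_pos hlam]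
  have e : (∫ σ, P σ ∂(γ A ζ) - ∫ σ, N σ ∂(γ A ζ)) - (∫ σ, P σ ∂(γ A ζ') - ∫ σ, N σ ∂(γ A ζ')) =
      (∫ σ, P σ ∂(γ A ζ) - ∫ σ, P σ ∂(γ A ζ')) - (∫ σ, N σ ∂(γ A ζ) - ∫ σ, N σ ∂(γ A ζ')) := by
    ring
  rw [e]
  calc lam * |(∫ σ, P σ ∂(γ A ζ) - ∫ σ, P σ ∂(γ A ζ')) -
        (∫ σ, N σ ∂(γ A ζ) - ∫ σ, N σ ∂(γ A ζ'))|
      ≤ lam * ((F - 1) * max ((γ A ζ).real E) ((γ A ζ').real E) +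
          (F - 1) * max ((γ A ζ).real E) ((γ A ζ').real E)) :=
        mul_le_mul_of_nonneg_left ((abs_sub _ _).trans (add_le_add hPb hNb)) hlam.le
    _ = 2 * (F - 1) * lam * max ((γ A ζ).real E) ((γ A ζ').real E) := by ring

end Literature.Probability.LatticeModels
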